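import Mathlib
import Literature.Combinatorics.Optimization.PatternMatrixPsdRank
import Literature.Barriers.PneNP.TSPExtensionComplexity
import Literature.Combinatorics.Optimization.BlockPsdLiftFactorization
import HarnessLib

/-!
# Psd rank of the cut, TSP and stable-set polytopes (Lee–Raghavendra–Steurer 2015, Cor. 1.2)

Companion of `CorrelationPolytopePsdRank.lean` (LRS Thm 1.1 = 5.4: `rk_psd(CORR_n) ≥ 2^{α n^{2/13}}`,
the named fact `LeeRaghavendraSteurer2015_thm11`), which says in its docstring that the bound
"transfers to `CUT_n`, `TSP_n`, `STAB_n` (LRS Cor. 1.2)" without typing the transfer.  This file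
TYPES Corollary 1.2 as three cited NAMED FACTS (not proved here), in the same currency as
`LeeRaghavendraSteurer2015_thm11`: "`rk_psd(P) ≥ R`" for a polytope `P = conv(V)` is rendered as
"the FULL slack matrix of `P` — rows: all linear inequalities `⟨a, ·⟩ ≤ b` valid on `V`, columns:
the points of `V`, entry `b − ⟨a, v⟩` — has no positive-semidefinite factorisation
(`HasPsdFactorization`, LRS Def. 1.7) of size `m < R`".  By LRS Prop. 1.10 (`rk_psd(P)` = psd rank
of any slack matrix of `P` = least size of a psd lift) the printed bound implies this form, since
every slack matrix of `P` is a row-submatrix of the full one (`fullSlackMatrix` below).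

Source: J. R. Lee, P. Raghavendra, D. Steurer, *Lower bounds on the size of semidefinite programming
relaxations*, STOC 2015 [LeeRaghavendraSteurer2015]; held text `paper:arxiv-1411.6317` (locators =
theorem numbers / pages of the arXiv rendering, as in the sibling files).

Printed statements (p. 4, verbatim up to notation).  "For `n ≥ 1`, let `K_n = ([n], C([n],2))` be the
complete graph on `n` vertices. For a set `S ⊆ [n]`, we use `∂S ⊆ C([n],2)` to denote the set of edges
with one endpoint in `S` and the other in `S̄`, and … `𝟙_{∂S} ∈ ℝ^{C(n,2)}` … The cut polytope on
`n` vertices is `CUT_n = conv({𝟙_{∂S} : S ⊆ [n]})`.  … if `τ` is a salesman tour of `K_n` (i.e., a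
Hamiltonian cycle), `𝟙_{E(τ)} ∈ ℝ^{C(n,2)}` … `TSP_n = conv({𝟙_{E(τ)} : τ is a Hamiltonian cycle})`.
… for an `n`-vertex graph `G = ([n], E)` … `STAB_n(G) = conv({𝟙_S ∈ ℝⁿ : S is an independent set in
G})`.  By results of [DeSimone90] and [FMPTW12] (see Prop. 5.2), Thm 1.1 directly implies …
**Corollary 1.2.** The following lower bounds hold for every `n ≥ 1`,
`rk_psd(CUT_n) ≥ 2^{Ω(n^{2/13})}`, `rk_psd(TSP_n) ≥ 2^{Ω(n^{1/13})}`,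
`max_{n-vertex G} rk_psd(STAB_n(G)) ≥ 2^{Ω(n^{1/13})}`."
(Prop. 5.2, p. 22: "`CORR_n` is linearly isomorphic to `CUT_{n+1}`" [DeSimone90]; "some face of
`TSP_{a_n}`, `a_n ≤ O(n²)`, linearly projects to `CORR_n`"; "there exists a graph `H_n` on
`b_n ≤ O(n²)` vertices such that some face of `STAB_{b_n}(H_n)` linearly projects to `CORR_n`"
[FMPTW12].)

**Fixed-size psd rank of the cut polytope (appended 2026-08-28, PROVED).** Fawzi–Parrilo
[cite: FawziParrilo2013, Thm. 1 and §1.2 (p. 4)]: "the polytope `COR(n)` is linearly isomorphic to the cut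
polytope … The result above thus rules out any polynomial-size formulation of the cut polytope … using
block-diagonal semidefinite programs."  Along the same De Simone map as for LRS Cor. 1.2, an
`(S^d_+)^r`-factorization of the full slack matrix of `CUT_{n+1}` restricts to one of `COR(n)`
(`FixedSizePsdRank.HasPsdPowerFactorization.corrSlack_of_cutSlack`), so FP13 Thm. 1
(`FawziParrilo2013_thm1_holds`) gives `κ(d)·c(d)ⁿ ≤ r` for `n ≥ d ≥ 1` (`FawziParrilo2013_cut`), and — by the
lift ⇒ factorization theorem `HasBlockPsdLift.hasPsdPowerFactorization_slack` — the same for every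
`(S^d_+)^r`-LIFT of `CUT_{n+1} = conv{𝟙_{∂S}}` (`FawziParrilo2013_cut_lift`).

Rendering decisions.  Edges of `K_n` are the tree's `(⊤ : SimpleGraph (Fin n)).edgeSet` and tours /
their characteristic vectors are the tree's `Literature.Barriers.PneNP.IsTourEdgeSet` / `charVec`
(so `TSP_n` here is the vertex set of the tree's `tspPolytope n`); `𝟙_{∂S}` is `cutVector S`;
independent sets of `G : SimpleGraph (Fin n)` are finsets with no adjacent pair.  The `Ω`'s are
unfolded as "there are `α > 0` and `n₀` with … for all `n ≥ n₀`" — a recorded repair of the printed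
"for every `n ≥ 1`": `CUT_1` is a point and `TSP_n = ∅` for `n ≤ 2`, where a bound `> 1` cannot
hold literally; the asymptotic content is unchanged.  `2^{α n^{2/13}}` uses `Real.rpow`.
-/

noncomputable section

open Finset Matrix
open scoped MatrixOrder

namespace Literature.Combinatorics.Optimization

open Literature.Barriers.PneNP (IsTourEdgeSet charVec)

/-! ### Full slack matrices of point families -/

/-- The **full slack matrix** of a family of points `v : κ → ℝ^ι` (equivalently of the polytope
`conv{v j}`): rows are ALL linear inequalities `⟨a, x⟩ ≤ b` valid on every `v j`, columns are the
points, entry `b − ⟨a, v j⟩ ≥ 0`.  Every slack matrix of `conv{v j}` with respect to a system of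
valid inequalities is a row-submatrix. [cite: LeeRaghavendraSteurer2015, §1.3 (p. 7: "The slack matrix S associated to P … S_{i,j} = b_i − ⟨a_i, x_j⟩")] -/
def fullSlackMatrix {ι κ : Type*} [Fintype ι] (v : κ → ι → ℝ) :
    {ab : (ι → ℝ) × ℝ // ∀ j, ab.1 ⬝ᵥ v j ≤ ab.2} → κ → ℝ :=
  fun ab j => ab.1.2 - ab.1.1 ⬝ᵥ v j

/-! ### The three vertex families -/

/-- `𝟙[e ∈ ∂S]` for an unordered pair `e = {i, j}`: exactly one endpoint lies in `S`.
[cite: LeeRaghavendraSteurer2015, §1.1 (p. 4: "∂S … the set of edges with one endpoint in S and the other in S̄")] -/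
def cutIndicator {n : ℕ} (S : Finset (Fin n)) : Sym2 (Fin n) → Bool :=
  Sym2.lift ⟨fun i j => xor (decide (i ∈ S)) (decide (j ∈ S)), fun _ _ => Bool.xor_comm _ _⟩

/-- The cut vector `𝟙_{∂S} ∈ ℝ^{E(K_n)}` of `S ⊆ [n]` — the vertices of `CUT_n = conv{𝟙_{∂S} : S ⊆ [n]}`.
[cite: LeeRaghavendraSteurer2015, §1.1 (p. 4)] -/
def cutVector {n : ℕ} (S : Finset (Fin n)) : (⊤ : SimpleGraph (Fin n)).edgeSet → ℝ :=
  fun e => if cutIndicator S (e : Sym2 (Fin n)) then 1 else 0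

/-- The tours (Hamiltonian cycles, as edge sets) of `K_n` — the index set of the vertices
`𝟙_{E(τ)}` of `TSP_n`; the tree's `IsTourEdgeSet`. [cite: LeeRaghavendraSteurer2015, §1.1 (p. 4)] -/
def Tours (n : ℕ) : Type := {F : Finset (Sym2 (Fin n)) // IsTourEdgeSet F}

/-- The vertex `𝟙_{E(τ)} ∈ ℝ^{E(K_n)}` of `TSP_n` indexed by a tour (the tree's `charVec`).
[cite: LeeRaghavendraSteurer2015, §1.1 (p. 4)] -/
def tourVector {n : ℕ} (τ : Tours n) : (⊤ : SimpleGraph (Fin n)).edgeSet → ℝ := charVec τ.1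

/-- The independent (stable) sets of an `n`-vertex graph `G`: vertex sets with no edge inside.
[cite: LeeRaghavendraSteurer2015, §1.1 (p. 4: "S ⊆ [n] is an independent set (also called a stable set) if there are no edges between vertices in S")] -/
def StableSets {n : ℕ} (G : SimpleGraph (Fin n)) : Type :=
  {S : Finset (Fin n) // ∀ i ∈ S, ∀ j ∈ S, ¬ G.Adj i j}

/-- The vertex `𝟙_S ∈ ℝⁿ` of `STAB_n(G)` indexed by a stable set `S`.
[cite: LeeRaghavendraSteurer2015, §1.1 (p. 4)] -/
def stableSetVector {n : ℕ} {G : SimpleGraph (Fin n)} (S : StableSets G) : Fin n → ℝ :=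
  fun i => if i ∈ S.1 then 1 else 0

/-! ### The named facts (LRS Corollary 1.2) -/

/-- **Lee–Raghavendra–Steurer 2015, Corollary 1.2 (cut polytope):** "`rk_psd(CUT_n) ≥ 2^{Ω(n^{2/13})}`"
— there are `α > 0` and `n₀` such that for all `n ≥ n₀` the full slack matrix of
`CUT_n = conv{𝟙_{∂S} : S ⊆ [n]} ⊆ ℝ^{E(K_n)}` has no psd factorisation of size `m < 2^{α n^{2/13}}`
(via De Simone's linear isomorphism `CORR_{n−1} ≅ CUT_n`, Prop. 5.2, and Thm 1.1). PROVED below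
MODULO Thm 1.1: `LeeRaghavendraSteurer2015_cor12_cut_of_thm11` (the De Simone step is formalised).
[cite: LeeRaghavendraSteurer2015, Cor. 1.2 (p. 4)] -/
def LeeRaghavendraSteurer2015_cor12_cut : Prop :=
  ∃ α : ℝ, 0 < α ∧ ∃ n₀ : ℕ, ∀ n : ℕ, n₀ ≤ n → ∀ m : ℕ,
    (m : ℝ) < (2 : ℝ) ^ (α * (n : ℝ) ^ ((2 : ℝ) / 13)) →
    ¬ HasPsdFactorization (fullSlackMatrix (cutVector (n := n))) m

/-- **Lee–Raghavendra–Steurer 2015, Corollary 1.2 (TSP polytope):** "`rk_psd(TSP_n) ≥ 2^{Ω(n^{1/13})}`"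
— there are `α > 0` and `n₀` such that for all `n ≥ n₀` the full slack matrix of
`TSP_n = conv{𝟙_{E(τ)} : τ a Hamiltonian cycle of K_n}` has no psd factorisation of size
`m < 2^{α n^{1/13}}` (via FMPTW: a face of `TSP_{O(n²)}` projects onto `CORR_n`, Prop. 5.2).
In particular no polynomial-size semidefinite extended formulation of the TSP polytope exists
(LRS Prop. 1.10). NOT proved here. [cite: LeeRaghavendraSteurer2015, Cor. 1.2 (p. 4)] -/
def LeeRaghavendraSteurer2015_cor12_tsp : Prop :=
  ∃ α : ℝ, 0 < α ∧ ∃ n₀ : ℕ, ∀ n : ℕ, n₀ ≤ n → ∀ m : ℕ,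
    (m : ℝ) < (2 : ℝ) ^ (α * (n : ℝ) ^ ((1 : ℝ) / 13)) →
    ¬ HasPsdFactorization (fullSlackMatrix (tourVector (n := n))) m

/-- **Lee–Raghavendra–Steurer 2015, Corollary 1.2 (stable-set polytopes):**
"`max_{n-vertex G} rk_psd(STAB_n(G)) ≥ 2^{Ω(n^{1/13})}`" — there are `α > 0` and `n₀` such that for
all `n ≥ n₀` some graph `G` on `[n]` has a stable-set polytope
`STAB_n(G) = conv{𝟙_S : S independent in G}` whose full slack matrix has no psd factorisation of size
`m < 2^{α n^{1/13}}` (via FMPTW: a face of `STAB(H_n)`, `|H_n| = O(n²)`, projects onto `CORR_n`,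
Prop. 5.2). NOT proved here. [cite: LeeRaghavendraSteurer2015, Cor. 1.2 (p. 4)] -/
def LeeRaghavendraSteurer2015_cor12_stab : Prop :=
  ∃ α : ℝ, 0 < α ∧ ∃ n₀ : ℕ, ∀ n : ℕ, n₀ ≤ n → ∃ G : SimpleGraph (Fin n), ∀ m : ℕ,
    (m : ℝ) < (2 : ℝ) ^ (α * (n : ℝ) ^ ((1 : ℝ) / 13)) →
    ¬ HasPsdFactorization (fullSlackMatrix (stableSetVector (G := G))) m

/-! ### Appended (proofs): nonnegativity; De Simone's map `CORR_n ≅ CUT_{n+1}` and Cor. 1.2 (cut) from Thm 1.1 -/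

/-- Entries of a full slack matrix are nonnegative. [cite: LeeRaghavendraSteurer2015, §1.3 (p. 7: "S ∈ ℝ_{≥0}^{m × v}")] -/
theorem fullSlackMatrix_nonneg {ι κ : Type*} [Fintype ι] (v : κ → ι → ℝ)
    (ab : {ab : (ι → ℝ) × ℝ // ∀ j, ab.1 ⬝ᵥ v j ≤ ab.2}) (j : κ) :
    0 ≤ fullSlackMatrix v ab j :=
  sub_nonneg.mpr (ab.2 j)


namespace DeSimone

variable {n : ℕ}

/-- The edge `{castSucc i, last}` of `K_{n+1}`. [cite: LeeRaghavendraSteurer2015, Prop. 5.2 (p. 22)] -/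
def edgeLast (i : Fin n) : (⊤ : SimpleGraph (Fin (n + 1))).edgeSet :=
  ⟨s(Fin.castSucc i, Fin.last n), by
    rw [SimpleGraph.mem_edgeSet]; exact (Fin.castSucc_lt_last i).ne⟩

/-- The edge `{castSucc i, castSucc j}` of `K_{n+1}` for `i ≠ j`. [cite: LeeRaghavendraSteurer2015, Prop. 5.2 (p. 22)] -/
def edgePair (i j : Fin n) (h : i ≠ j) : (⊤ : SimpleGraph (Fin (n + 1))).edgeSet :=
  ⟨s(Fin.castSucc i, Fin.castSucc j), by
    rw [SimpleGraph.mem_edgeSet]; exact fun h' => h (Fin.castSucc_injective _ h')⟩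

/-- The covariance-map coefficient vector of the monomial `x_i x_j` on `ℝ^{E(K_{n+1})}`:
`x_i = δ_{i,last}`, `x_i x_j = (δ_{i,last} + δ_{j,last} − δ_{ij})/2` (`i ≠ j`) — De Simone's
covariance map `CORR_n ≅ CUT_{n+1}`. [cite: LeeRaghavendraSteurer2015, Prop. 5.2 (p. 22: "CORR_n is linearly isomorphic to CUT_{n+1}" [DeSimone90])] -/
def monoVec (i j : Fin n) : (⊤ : SimpleGraph (Fin (n + 1))).edgeSet → ℝ :=
  if h : i = j then Pi.single (edgeLast i) 1
  else (1 / 2 : ℝ) • (Pi.single (edgeLast i) 1 + Pi.single (edgeLast j) 1 - Pi.single (edgePair i j h) 1)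

/-- The pulled-back coefficient vector of a quadratic form `Σ C_ij x_i x_j`. [cite: LeeRaghavendraSteurer2015, Prop. 5.2 (p. 22)] -/
def pullVec (C : Matrix (Fin n) (Fin n) ℝ) : (⊤ : SimpleGraph (Fin (n + 1))).edgeSet → ℝ :=
  ∑ i, ∑ j, C i j • monoVec i j

/-- The 0/1 coordinates `x^S_i = δ(S)_{i,last}` of a cut. [cite: LeeRaghavendraSteurer2015, Prop. 5.2 (p. 22)] -/
def cutCoord (S : Finset (Fin (n + 1))) (i : Fin n) : ℝ := cutVector S (edgeLast i)

/-- `x^S_i ∈ {0,1}`. [folklore] -/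
private theorem cutCoord_zero_or_one (S : Finset (Fin (n + 1))) (i : Fin n) :
    cutCoord S i = 0 ∨ cutCoord S i = 1 := by
  unfold cutCoord cutVector
  split_ifs <;> simp

/-- `δ(S)_{i,last} = x^S_i`. [folklore] -/
private theorem cutVector_edgeLast (S : Finset (Fin (n + 1))) (i : Fin n) :
    cutVector S (edgeLast i) = cutCoord S i := rfl

/-- `δ(S)_{ij} = x_i + x_j − 2 x_i x_j` (an edge is cut iff its endpoints lie on different sides of
`last`). [cite: LeeRaghavendraSteurer2015, Prop. 5.2 (p. 22)] -/
theorem cutVector_edgePair (S : Finset (Fin (n + 1))) (i j : Fin n) (h : i ≠ j) :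
    cutVector S (edgePair i j h) = cutCoord S i + cutCoord S j - 2 * (cutCoord S i * cutCoord S j) := by
  simp only [cutCoord, cutVector, edgePair, edgeLast, cutIndicator, Sym2.lift_mk]
  by_cases hi : Fin.castSucc i ∈ S <;> by_cases hj : Fin.castSucc j ∈ S <;>
    by_cases hl : Fin.last n ∈ S <;> simp [hi, hj, hl] <;> norm_num

/-- `⟨monoVec i j, δ(S)⟩ = x^S_i x^S_j`. [cite: LeeRaghavendraSteurer2015, Prop. 5.2 (p. 22)] -/
theorem monoVec_dotProduct (i j : Fin n) (S : Finset (Fin (n + 1))) :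
    monoVec i j ⬝ᵥ cutVector S = cutCoord S i * cutCoord S j := by
  unfold monoVec
  split_ifs with h
  · subst h
    rw [single_dotProduct, one_mul, cutVector_edgeLast]
    rcases cutCoord_zero_or_one S i with h0 | h1
    · rw [h0]; ring
    · rw [h1]; ring
  · rw [smul_dotProduct, sub_dotProduct, add_dotProduct, single_dotProduct, single_dotProduct,
      single_dotProduct, one_mul, one_mul, one_mul, cutVector_edgeLast, cutVector_edgeLast,
      cutVector_edgePair, smul_eq_mul]
    ring

/-- `⟨pullVec C, δ(S)⟩ = Σ C_ij x^S_i x^S_j`. [cite: LeeRaghavendraSteurer2015, Prop. 5.2 (p. 22)] -/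
theorem pullVec_dotProduct (C : Matrix (Fin n) (Fin n) ℝ) (S : Finset (Fin (n + 1))) :
    pullVec C ⬝ᵥ cutVector S = ∑ i, ∑ j, C i j * (cutCoord S i * cutCoord S j) := by
  unfold pullVec
  rw [sum_dotProduct]
  refine sum_congr rfl fun i _ => ?_
  rw [sum_dotProduct]
  refine sum_congr rfl fun j _ => ?_
  rw [smul_dotProduct, monoVec_dotProduct, smul_eq_mul]

/-- The cut `S_x = {castSucc i : x_i = 1}` of a 0/1 point (the inverse of the covariance map on
vertices). [cite: LeeRaghavendraSteurer2015, Prop. 5.2 (p. 22)] -/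
def cutOf (x : {x : Fin n → ℝ // ∀ i, x i = 0 ∨ x i = 1}) : Finset (Fin (n + 1)) :=
  (univ.filter fun i : Fin n => x.1 i = 1).map Fin.castSuccEmb

/-- `x^{S_x} = x`. [cite: LeeRaghavendraSteurer2015, Prop. 5.2 (p. 22)] -/
theorem cutCoord_cutOf (x : {x : Fin n → ℝ // ∀ i, x i = 0 ∨ x i = 1}) (i : Fin n) :
    cutCoord (cutOf x) i = x.1 i := by
  have hlast : Fin.last n ∉ cutOf x := by
    simp only [cutOf, mem_map, mem_filter, mem_univ, true_and, not_exists, not_and]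
    exact fun j _ => (Fin.castSucc_lt_last j).ne
  have hi : (Fin.castSucc i ∈ cutOf x) ↔ x.1 i = 1 := by
    simp only [cutOf, mem_map, mem_filter, mem_univ, true_and, Fin.castSuccEmb_apply]
    constructor
    · rintro ⟨j, hj, hji⟩
      rwa [← Fin.castSucc_injective _ hji]
    · exact fun h => ⟨i, h, rfl⟩
  simp only [cutCoord, cutVector, edgeLast, cutIndicator, Sym2.lift_mk]
  rcases x.2 i with h0 | h1
  · have : ¬ (Fin.castSucc i ∈ cutOf x) := by rw [hi, h0]; norm_num
    simp [this, hlast, h0]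
  · have : Fin.castSucc i ∈ cutOf x := hi.mpr h1
    simp [this, hlast, h1]

end DeSimone

open DeSimone in
/-- **LRS Prop. 5.2(1) [De Simone] in factorisation form (PROVED):** a psd factorisation of size `m`
of the full slack matrix of `CUT_{n+1}` restricts, along the covariance map
`x_i = δ_{i,n+1}`, `x_i x_j = (δ_{i,n+1} + δ_{j,n+1} − δ_{ij})/2`, to one of the full slack matrix of
`CORR_n` (rows: valid quadratic inequalities on `{0,1}ⁿ`; columns: `x ∈ {0,1}ⁿ`) — the matrix negated in
`LeeRaghavendraSteurer2015_thm11`. [cite: LeeRaghavendraSteurer2015, Prop. 5.2 (p. 22)] -/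
theorem HasPsdFactorization.corrSlack_of_cutSlack {n m : ℕ}
    (h : HasPsdFactorization (fullSlackMatrix (cutVector (n := n + 1))) m) :
    ∃ (U : {cb : Matrix (Fin n) (Fin n) ℝ × ℝ //
              ∀ x : Fin n → ℝ, (∀ i, x i = 0 ∨ x i = 1) →
                ∑ i, ∑ j, cb.1 i j * (x i * x j) ≤ cb.2} → Matrix (Fin m) (Fin m) ℝ)
      (V : {x : Fin n → ℝ // ∀ i, x i = 0 ∨ x i = 1} → Matrix (Fin m) (Fin m) ℝ),
      (∀ cb, (U cb).PosSemidef) ∧ (∀ x, (V x).PosSemidef) ∧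
      ∀ cb x, cb.1.2 - ∑ i, ∑ j, cb.1.1 i j * (x.1 i * x.1 j) = Matrix.trace (U cb * V x) := by
  obtain ⟨A, B, hA, hB, hM⟩ := h
  -- row map: (C, b) ↦ (pullVec C, b), valid on every cut
  have valid : ∀ cb : {cb : Matrix (Fin n) (Fin n) ℝ × ℝ //
      ∀ x : Fin n → ℝ, (∀ i, x i = 0 ∨ x i = 1) → ∑ i, ∑ j, cb.1 i j * (x i * x j) ≤ cb.2},
      ∀ S : Finset (Fin (n + 1)), pullVec cb.1.1 ⬝ᵥ cutVector S ≤ cb.1.2 := by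
    intro cb S
    rw [pullVec_dotProduct]
    exact cb.2 (cutCoord S) (cutCoord_zero_or_one S)
  refine ⟨fun cb => A ⟨(pullVec cb.1.1, cb.1.2), valid cb⟩, fun x => B (cutOf x),
    fun cb => hA _, fun x => hB _, fun cb x => ?_⟩
  rw [← hM]
  simp only [fullSlackMatrix, pullVec_dotProduct, cutCoord_cutOf]

open DeSimone in
/-- **LRS Corollary 1.2 (cut) follows from Theorem 1.1** via De Simone's isomorphism
`CORR_n ≅ CUT_{n+1}` (Prop. 5.2(1)): with `α' = α/2` and `n ≥ 2`.
[cite: LeeRaghavendraSteurer2015, Cor. 1.2 and Prop. 5.2 (pp. 4, 22)] -/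
theorem LeeRaghavendraSteurer2015_cor12_cut_of_thm11 (h : LeeRaghavendraSteurer2015_thm11) :
    LeeRaghavendraSteurer2015_cor12_cut := by
  obtain ⟨α, hα, H⟩ := h
  refine ⟨α / 2, by positivity, 2, fun n hn m hm hfac => ?_⟩
  obtain ⟨n', rfl⟩ : ∃ n', n = n' + 1 := ⟨n - 1, by omega⟩
  have hn' : 1 ≤ n' := by omega
  -- the bound transfers: α/2 · (n'+1)^{2/13} ≤ α · n'^{2/13}
  have hpow : ((n' + 1 : ℕ) : ℝ) ^ ((2 : ℝ) / 13) ≤ 2 * (n' : ℝ) ^ ((2 : ℝ) / 13) := by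
    have h1 : ((n' + 1 : ℕ) : ℝ) ≤ 2 * n' := by push_cast; linarith [show (1 : ℝ) ≤ n' by exact_mod_cast hn']
    have h2 : (0 : ℝ) ≤ ((n' + 1 : ℕ) : ℝ) := by positivity
    calc ((n' + 1 : ℕ) : ℝ) ^ ((2 : ℝ) / 13) ≤ (2 * (n' : ℝ)) ^ ((2 : ℝ) / 13) :=
          Real.rpow_le_rpow h2 h1 (by norm_num)
      _ = (2 : ℝ) ^ ((2 : ℝ) / 13) * (n' : ℝ) ^ ((2 : ℝ) / 13) :=
          Real.mul_rpow (by norm_num) (by positivity)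
      _ ≤ 2 * (n' : ℝ) ^ ((2 : ℝ) / 13) := by
          have : (2 : ℝ) ^ ((2 : ℝ) / 13) ≤ 2 := by
            calc (2 : ℝ) ^ ((2 : ℝ) / 13) ≤ (2 : ℝ) ^ (1 : ℝ) :=
                  Real.rpow_le_rpow_of_exponent_le (by norm_num) (by norm_num)
              _ = 2 := Real.rpow_one 2
          exact mul_le_mul_of_nonneg_right this (by positivity)
  have hm' : (m : ℝ) < (2 : ℝ) ^ (α * (n' : ℝ) ^ ((2 : ℝ) / 13)) := by
    refine lt_of_lt_of_le hm (Real.rpow_le_rpow_of_exponent_le (by norm_num) ?_)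
    have : α / 2 * ((n' + 1 : ℕ) : ℝ) ^ ((2 : ℝ) / 13) ≤ α / 2 * (2 * (n' : ℝ) ^ ((2 : ℝ) / 13)) :=
      mul_le_mul_of_nonneg_left hpow (by positivity)
    linarith
  obtain ⟨U, V, hU, hV, hUV⟩ := hfac.corrSlack_of_cutSlack
  exact H n' hn' m hm' ⟨U, V, hU, hV, hUV⟩

/-! ### Fixed-size psd rank (`(S^d_+)^r`-lifts) of the cut polytope (Fawzi–Parrilo 2013) -/

section FixedSize

open DeSimone FixedSizePsdRank

/-- **De Simone's restriction for `(S^d_+)^r`-factorizations**: an `(S^d_+)^r`-factorization of the full slack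
matrix of `CUT_{n+1}` restricts, along the covariance map, to one of the full slack matrix `corrSlack n` of
`COR(n)` (block version of `HasPsdFactorization.corrSlack_of_cutSlack`).
[cite: FawziParrilo2013, §1.2 (p. 4, "COR(n) is linearly isomorphic to the cut polytope")]
[cite: LeeRaghavendraSteurer2015, Prop. 5.2 (p. 22)] -/
theorem FixedSizePsdRank.HasPsdPowerFactorization.corrSlack_of_cutSlack {n d r : ℕ}
    (h : HasPsdPowerFactorization (fullSlackMatrix (cutVector (n := n + 1))) d r) :
    HasPsdPowerFactorization (corrSlack n) d r := by
  have valid : ∀ cb : {cb : Matrix (Fin n) (Fin n) ℝ × ℝ //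
      ∀ x : Fin n → ℝ, (∀ i, x i = 0 ∨ x i = 1) → ∑ i, ∑ j, cb.1 i j * (x i * x j) ≤ cb.2},
      ∀ S : Finset (Fin (n + 1)), pullVec cb.1.1 ⬝ᵥ cutVector S ≤ cb.1.2 := by
    intro cb S
    rw [pullVec_dotProduct]
    exact cb.2 (cutCoord S) (cutCoord_zero_or_one S)
  have h' := h.submatrix
    (fun cb : {cb : Matrix (Fin n) (Fin n) ℝ × ℝ //
        ∀ x : Fin n → ℝ, (∀ i, x i = 0 ∨ x i = 1) → ∑ i, ∑ j, cb.1 i j * (x i * x j) ≤ cb.2} =>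
      (⟨(pullVec cb.1.1, cb.1.2), valid cb⟩ :
        {ab : ((⊤ : SimpleGraph (Fin (n + 1))).edgeSet → ℝ) × ℝ // ∀ S, ab.1 ⬝ᵥ cutVector S ≤ ab.2}))
    (fun x : {x : Fin n → ℝ // ∀ i, x i = 0 ∨ x i = 1} => cutOf x)
  have heq : (fun (cb : {cb : Matrix (Fin n) (Fin n) ℝ × ℝ //
        ∀ x : Fin n → ℝ, (∀ i, x i = 0 ∨ x i = 1) → ∑ i, ∑ j, cb.1 i j * (x i * x j) ≤ cb.2})
      (x : {x : Fin n → ℝ // ∀ i, x i = 0 ∨ x i = 1}) =>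
      fullSlackMatrix (cutVector (n := n + 1)) ⟨(pullVec cb.1.1, cb.1.2), valid cb⟩ (cutOf x)) = corrSlack n := by
    funext cb x
    simp only [fullSlackMatrix, pullVec_dotProduct, cutCoord_cutOf]
    rfl
  exact heq ▸ h'

/-- **Fawzi–Parrilo 2013 for the cut polytope, factorization form**: an `(S^d_+)^r`-factorization of the full
slack matrix of `CUT_{n+1}` (`n ≥ d ≥ 1`) has `κ(d)·c(d)ⁿ ≤ r`, `c(d) = (1 − 3^{−d})^{−1/d}`,
`κ(d) = (3^d − 1)^{−(1−1/d)}` ("rules out any polynomial-size formulation of the cut polytope … using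
block-diagonal semidefinite programs"). [cite: FawziParrilo2013, Thm. 1 and §1.2 (p. 4)] -/
theorem FawziParrilo2013_cut {n d r : ℕ} (hd : 1 ≤ d) (hnd : d ≤ n)
    (h : HasPsdPowerFactorization (fullSlackMatrix (cutVector (n := n + 1))) d r) :
    ((3 : ℝ) ^ d - 1) ^ (-(1 - 1 / (d : ℝ))) * ((1 - 1 / (3 : ℝ) ^ d) ^ (-(1 / (d : ℝ)))) ^ n ≤ (r : ℝ) :=
  FawziParrilo2013_thm1_holds d hd n hnd r h.corrSlack_of_cutSlack

/-- The cut polytope `CUT_N = conv{𝟙_{∂S} : S ⊆ [N]}` is bounded. [cite: LeeRaghavendraSteurer2015, §1.1 (p. 4)] -/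
theorem isBounded_convexHull_cutVector (N : ℕ) :
    Bornology.IsBounded (convexHull ℝ (Set.range (cutVector (n := N)))) :=
  isBounded_convexHull.2 (Set.finite_range _).isBounded

/-- Inequalities valid on all cut vectors are valid on `CUT_N`. [cite: LeeRaghavendraSteurer2015, §1.3 (p. 7)] -/
theorem dotProduct_le_of_mem_convexHull_cutVector {N : ℕ} {y : (⊤ : SimpleGraph (Fin N)).edgeSet → ℝ}
    (hy : y ∈ convexHull ℝ (Set.range (cutVector (n := N))))
    (ab : {ab : ((⊤ : SimpleGraph (Fin N)).edgeSet → ℝ) × ℝ // ∀ S, ab.1 ⬝ᵥ cutVector S ≤ ab.2}) :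
    ab.1.1 ⬝ᵥ y ≤ ab.1.2 := by
  have hlin : IsLinearMap ℝ (fun z : (⊤ : SimpleGraph (Fin N)).edgeSet → ℝ => ab.1.1 ⬝ᵥ z) :=
    ⟨fun u v => dotProduct_add _ _ _, fun s u => dotProduct_smul s ab.1.1 u⟩
  refine (convexHull_min ?_ (convex_halfSpace_le hlin _)) hy
  rintro _ ⟨S, rfl⟩
  exact ab.2 S

/-- **Fawzi–Parrilo 2013 for the cut polytope, lift form**: an `(S^d_+)^r`-lift (`HasBlockPsdLift`) of
`CUT_{n+1} = conv{𝟙_{∂S} : S ⊆ [n+1]}`, `n ≥ d ≥ 1`, has `κ(d)·c(d)ⁿ ≤ r`.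
[cite: FawziParrilo2013, Thm. 1 and §1.2 (p. 4)] -/
theorem FawziParrilo2013_cut_lift {n d r : ℕ} (hd : 1 ≤ d) (hnd : d ≤ n)
    (h : HasBlockPsdLift (convexHull ℝ (Set.range (cutVector (n := n + 1)))) d r) :
    ((3 : ℝ) ^ d - 1) ^ (-(1 - 1 / (d : ℝ))) * ((1 - 1 / (3 : ℝ) ^ d) ^ (-(1 / (d : ℝ)))) ^ n ≤ (r : ℝ) := by
  have hn : 0 < n := by omega
  -- `r ≥ 1`: `CUT_{n+1}` has two distinct points
  have hr : 1 ≤ r := by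
    rcases Nat.eq_zero_or_pos r with rfl | hr
    · exfalso
      obtain ⟨L, π, hC⟩ := h
      have hsub : (convexHull ℝ (Set.range (cutVector (n := n + 1)))).Subsingleton := by
        rw [hC]
        rintro _ ⟨M, -, rfl⟩ _ ⟨M', -, rfl⟩
        have : M = M' := funext fun t => t.elim0
        rw [this]
      let x0 : {x : Fin n → ℝ // ∀ i, x i = 0 ∨ x i = 1} := ⟨fun _ => 0, fun _ => Or.inl rfl⟩
      let x1 : {x : Fin n → ℝ // ∀ i, x i = 0 ∨ x i = 1} := ⟨fun _ => 1, fun _ => Or.inr rfl⟩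
      have h0 : cutVector (cutOf x0) ∈ convexHull ℝ (Set.range (cutVector (n := n + 1))) :=
        subset_convexHull ℝ _ ⟨_, rfl⟩
      have h1 : cutVector (cutOf x1) ∈ convexHull ℝ (Set.range (cutVector (n := n + 1))) :=
        subset_convexHull ℝ _ ⟨_, rfl⟩
      have := congrFun (hsub h0 h1) (edgeLast ⟨0, hn⟩)
      have e0 := cutCoord_cutOf x0 ⟨0, hn⟩
      have e1 := cutCoord_cutOf x1 ⟨0, hn⟩
      simp only [cutCoord] at e0 e1
      rw [e0, e1] at this
      exact zero_ne_one this
    · exact hr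
  have hfac : HasPsdPowerFactorization
      (fun (S : Finset (Fin (n + 1)))
        (ab : {ab : ((⊤ : SimpleGraph (Fin (n + 1))).edgeSet → ℝ) × ℝ // ∀ S, ab.1 ⬝ᵥ cutVector S ≤ ab.2}) =>
        ab.1.2 - ab.1.1 ⬝ᵥ cutVector S) d r :=
    HasBlockPsdLift.hasPsdPowerFactorization_slack (x := fun S : Finset (Fin (n + 1)) => cutVector S)
      (a := fun ab : {ab : ((⊤ : SimpleGraph (Fin (n + 1))).edgeSet → ℝ) × ℝ //
        ∀ S, ab.1 ⬝ᵥ cutVector S ≤ ab.2} => ab.1.1) (b := fun ab => ab.1.2) hd hr h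
      (isBounded_convexHull_cutVector (n + 1)) (fun S => subset_convexHull ℝ _ ⟨S, rfl⟩)
      (fun y hy ab => dotProduct_le_of_mem_convexHull_cutVector hy ab)
  exact FawziParrilo2013_cut hd hnd hfac.transpose

end FixedSize

end Literature.Combinatorics.Optimization

end
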